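import Mathlib.Algebra.Order.Ring.Defs
import Mathlib.Algebra.Order.Ring.Int
import Mathlib.Algebra.Group.Prod
import Mathlib.Data.Finset.Insert
import Mathlib.Data.Finset.Lattice.Basic
import Mathlib.Data.Fintype.Basic
import HarnessLib

/-!
# Knapp–Zuckerman data `(λ, Ψ)` for limits of discrete series: discrete series, non-vanishing,
# non-degeneracy — the purely combinatorial root-data predicates

Topic `Literature/RepresentationTheory/Semisimple` (namespace
`Literature.RepresentationTheory.Semisimple`); definition item `defn-LimitOfDiscreteSeriesData`
(route `Langlands/GSpinCensusRung`, item LimitWeightGaloisRep; also `Langlands/DegenerateLimits`).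
Everything here is a definition with a body or a PROVED (mostly `decide`d) theorem; no named facts,
no analysis, no `(𝔤, K)`-modules.  The `U(p,q)` special case, with chambers as enumerations and
Harish-Chandra parameters in `ℚ^{p+q}`, is the tree's
`Literature.NumberTheory.Automorphic.LDSDatum` (`UnitaryLimitsOfDiscreteSeries.lean`); the present
file is the root-datum form needed for other groups (`so(2,5)`, `sp₄ ≅ so(2,3)`, …).

## Setting (as printed)

`G` a connected linear semisimple (or reductive) real group with a compact Cartan subgroup
`T ⊆ K` (`rank G = rank K`); `Φ = Δ(𝔤_ℂ, 𝔱_ℂ)` its roots (all imaginary; each compact — a root of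
`K` — or noncompact); `Φ_c ⊆ Φ` the compact roots.  "A limit of discrete series representation … is
determined by its Harish-Chandra parameter `λ`, which gives the infinitesimal character, and by a
Weyl chamber `C` (or positive system for `Δ(𝔪_ℂ, 𝔟_ℂ)`) that makes `λ` dominant … If `λ` is
nonsingular, then `C` is unique and the representation is in the discrete series"
[CarayolKnapp2007, §2, before (2.4)]; "`Θ^M(λ, C, χ) = 0` if and only if `⟨λ, α⟩ = 0` for some
`C`-simple compact root `α`" [CarayolKnapp2007, (2.4): sufficiency = Hecht–Schmid, necessity =
KnappZuckerman1982 Thm 1.1(b)]; "nondegenerate data [KnappZuckerman1982, §12]: for each root `α̃`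
with `⟨λ, α̃⟩ = 0` the reflection `s_α̃` is not in `W(B* : M*)`" [CarayolKnapp2007, §2] — for a
compact Cartan (`M = G`) this reads: NO COMPACT ROOT is orthogonal to `λ` (these are the
"non-degenerate limits of discrete series" of [GoldringKoskivirta2019, §2.2.2], the archimedean
components seen by coherent cohomology of Shimura varieties, and of [BoxerEtAl2021, §1.4.1]).

## What is formalised

* `LimitOfDiscreteSeriesData pair` — for an abelian group `V` (the weight space) with a pairing
  `pair : V → V → R` into an ordered ring (the invariant form; only `⟨λ, α⟩`, its vanishing and its
  sign are used, so `⟨λ, α^∨⟩ = 2⟨λ, α⟩/⟨α, α⟩` may be replaced by `⟨λ, α⟩`): finite sets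
  `roots ⊇ compactRoots` (symmetric) and `positiveRoots ⊆ roots` (a positive system: exactly one
  of `α`, `−α` for each root) and the parameter `param = λ`, dominant: `0 ≤ ⟨λ, α⟩` on
  `positiveRoots`.  (That `roots` is a genuine reduced root system, `compactRoots` a closed
  subsystem and `positiveRoots` closed under addition is INTENDED but not enforced: the three
  predicates below do not need it, and the worked examples are honest root systems.)
* `IsSimpleRoot` (`Ψ`-simple = in `Ψ` and not a sum of two members of `Ψ`),
  `IsDiscreteSeries` (`λ` regular: orthogonal to no root), `IsNonzeroLimit` (no compact
  `Ψ`-simple root orthogonal to `λ`), `IsNondegenerateLimit` (no compact root orthogonal to `λ`),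
  with `IsDiscreteSeries → IsNondegenerateLimit → IsNonzeroLimit` proved and decidability.
* Worked lines (census C1 of the Langlands idea card `cy3-h21-two-gspin-census`), all by `decide`
  over INTEGER coordinate tuples (the half-integral parameters are DOUBLED; the predicates are
  invariant under positive scaling of `λ`): type `B₃ = so(2,5)` in coordinates `(e₁; e₂, e₃)` with
  `Φ_c = {±e₂ ± e₃, ±e₂, ±e₃}` (`so(2) ⊕ so(5)`): `λ = (1/2, 3/2, 1/2)` (Hodge type `(1,2,2,1)`) is
  orthogonal exactly to the noncompact `±(e₁ − e₃)` — a non-degenerate limit, not discrete series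
  (`so25Hodge1221_*`); `λ = (1/2, 1/2, 1/2)` (Hodge `(3,3)`) is orthogonal to the compact `e₂ − e₃`
  — degenerate (`so25Hodge33_not_isNondegenerateLimit`), though nonzero for the chamber
  `e₂ > e₁ > e₃` (`so25Hodge33_isNonzeroLimit`); type `C₂ = sp₄ ≅ so(2,3)` with `Φ_c = ±(e₁ − e₂)`
  (roots of `U(2)`): the Siegel weight `(2,2)` parameter `λ = (1, 0)` is a non-degenerate limit, not
  discrete series (`sp4Siegel22_*`) [BoxerEtAl2021, §1.4.1].

NOT here: the representations `π(λ, Ψ)` themselves, Knapp–Zuckerman Thm 1.1(c) (conjugacy under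
`W_K`), integrality of `λ − ρ`, the `R`-group; a map `LDSDatum p q → LimitOfDiscreteSeriesData`.

## References
* A. W. Knapp, G. J. Zuckerman, *Classification of irreducible tempered representations of
  semisimple groups*, Ann. of Math. 116 (1982), Thm. 1.1(b), §12. [KnappZuckerman1982]
* H. Carayol, A. W. Knapp, *Limits of discrete series with infinitesimal character zero*,
  Trans. AMS 359 (2007), §2, (2.4). [CarayolKnapp2007]
* A. W. Knapp, D. A. Vogan, *Cohomological induction and unitary representations* (1995),
  §XI.8, Prop. 11.180. [KnappVogan1995]
* W. Goldring, J.-S. Koskivirta, Invent. Math. 217 (2019), §2.2.2. [GoldringKoskivirta2019]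
* G. Boxer, F. Calegari, T. Gee, V. Pilloni, Publ. IHÉS 134 (2021), §1.4.1. [BoxerEtAl2021]

## Mathlib / tree search
Mathlib's `RootPairing` / `RootSystem` carry no compact/noncompact structure and no
Harish-Chandra parameters; using them would not simplify the three predicates (which only need
finite sets and a pairing) and would make the worked lines undecidable in the kernel.  Tree:
`Literature.NumberTheory.Automorphic.LDSDatum` (`U(p,q)` only).  `lean search --decl
'LimitOfDiscreteSeries|IsNondegenerateLimit|HarishChandraParam'`: only `LDSDatum.*`.
-/

namespace Literature.RepresentationTheory.Semisimple

universe u v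

/-- **Knapp–Zuckerman data `(λ, Ψ)` for a (limit of) discrete series** of a group with a compact
Cartan subgroup, as pure root data: the roots `roots = Φ ⊆ V`, the compact roots
`compactRoots = Φ_c ⊆ Φ` (symmetric), a positive system `positiveRoots = Ψ ⊆ Φ` (exactly one of
`α, −α` for every root `α`) and the Harish-Chandra parameter `param = λ`, `Ψ`-dominant:
`0 ≤ ⟨λ, α⟩` for `α ∈ Ψ`, where `pair = ⟨·, ·⟩ : V → V → R` is the invariant form (only `⟨λ, ·⟩`
is used).  "determined by its Harish-Chandra parameter `λ` … and by a Weyl chamber `C` (or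
positive system …) that makes `λ` dominant". [cite: CarayolKnapp2007, §2 (before (2.4))]
[cite: KnappZuckerman1982, Thm. 1.1] -/
structure LimitOfDiscreteSeriesData {V : Type u} {R : Type v} [AddCommGroup V] [Ring R] [LE R]
    (pair : V → V → R) where
  /-- The roots `Φ = Δ(𝔤_ℂ, 𝔱_ℂ)`. -/
  roots : Finset V
  /-- The compact roots `Φ_c` (roots of `K`). -/
  compactRoots : Finset V
  /-- The positive system `Ψ` (Weyl chamber `C`). -/
  positiveRoots : Finset V
  /-- The Harish-Chandra parameter `λ`. -/
  param : V
  /-- `Φ_c ⊆ Φ`. -/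
  compact_subset : compactRoots ⊆ roots
  /-- `Φ_c = −Φ_c`. -/
  neg_mem_compact : ∀ α ∈ compactRoots, -α ∈ compactRoots
  /-- `Ψ ⊆ Φ`. -/
  positive_subset : positiveRoots ⊆ roots
  /-- `Φ = Ψ ∪ −Ψ`. -/
  mem_or_neg_mem : ∀ α ∈ roots, α ∈ positiveRoots ∨ -α ∈ positiveRoots
  /-- `Ψ ∩ −Ψ = ∅`. -/
  neg_notMem : ∀ α ∈ positiveRoots, -α ∉ positiveRoots
  /-- `λ` is `Ψ`-dominant. -/
  dominant : ∀ α ∈ positiveRoots, 0 ≤ pair param α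

namespace LimitOfDiscreteSeriesData

variable {V : Type u} {R : Type v} [AddCommGroup V] [Ring R] [LE R] {pair : V → V → R}

/-- `α` is a **`Ψ`-simple root**: `α ∈ Ψ` and `α` is not the sum of two members of `Ψ`
(for a positive system of a reduced root system these are the simple roots). [folklore] -/
def IsSimpleRoot (D : LimitOfDiscreteSeriesData pair) (α : V) : Prop :=
  α ∈ D.positiveRoots ∧ ∀ β ∈ D.positiveRoots, ∀ γ ∈ D.positiveRoots, β + γ ≠ α

/-- **`π(λ, Ψ)` is a discrete series**: `λ` is regular, `⟨λ, α⟩ ≠ 0` for every root `α`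
("If `λ` is nonsingular, then `C` is unique and the representation is in the discrete series").
[cite: CarayolKnapp2007, §2 (before (2.4))] -/
def IsDiscreteSeries (D : LimitOfDiscreteSeriesData pair) : Prop :=
  ∀ α ∈ D.roots, pair D.param α ≠ 0

/-- **`π(λ, Ψ) ≠ 0`**: no COMPACT `Ψ`-SIMPLE root is orthogonal to `λ` ("`Θ(λ, C, χ) = 0` if and
only if `⟨λ, α⟩ = 0` for some `C`-simple compact root `α`": sufficiency Hecht–Schmid, necessity
Knapp–Zuckerman Thm. 1.1(b)). [cite: CarayolKnapp2007, §2 (2.4)]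
[cite: KnappZuckerman1982, Thm. 1.1(b)] -/
def IsNonzeroLimit (D : LimitOfDiscreteSeriesData pair) : Prop :=
  ∀ α ∈ D.compactRoots, D.IsSimpleRoot α → pair D.param α ≠ 0

/-- **`(λ, Ψ)` is non-degenerate** (a non-degenerate limit of discrete series): NO compact root is
orthogonal to `λ` (Knapp–Zuckerman's "nondegenerate data", §12: no root `α̃ ⊥ λ` has its
reflection in `W(B : M)`, here `= W_K`; Goldring–Koskivirta's NDLDS).
[cite: KnappZuckerman1982, §12 (nondegenerate data)] [cite: CarayolKnapp2007, §2]
[cite: GoldringKoskivirta2019, §2.2.2] -/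
def IsNondegenerateLimit (D : LimitOfDiscreteSeriesData pair) : Prop :=
  ∀ α ∈ D.compactRoots, pair D.param α ≠ 0

variable {D : LimitOfDiscreteSeriesData pair}

/-- Unfolding lemma. [folklore] -/
theorem isSimpleRoot_iff {α : V} :
    D.IsSimpleRoot α ↔
      α ∈ D.positiveRoots ∧ ∀ β ∈ D.positiveRoots, ∀ γ ∈ D.positiveRoots, β + γ ≠ α :=
  Iff.rfl

/-- Unfolding lemma. [folklore] -/
theorem isDiscreteSeries_iff : D.IsDiscreteSeries ↔ ∀ α ∈ D.roots, pair D.param α ≠ 0 := Iff.rfl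

/-- Unfolding lemma. [folklore] -/
theorem isNonzeroLimit_iff :
    D.IsNonzeroLimit ↔ ∀ α ∈ D.compactRoots, D.IsSimpleRoot α → pair D.param α ≠ 0 := Iff.rfl

/-- Unfolding lemma. [folklore] -/
theorem isNondegenerateLimit_iff :
    D.IsNondegenerateLimit ↔ ∀ α ∈ D.compactRoots, pair D.param α ≠ 0 := Iff.rfl

/-- **Discrete series are non-degenerate** (`Φ_c ⊆ Φ`). [folklore] -/
theorem IsDiscreteSeries.isNondegenerateLimit (h : D.IsDiscreteSeries) : D.IsNondegenerateLimit :=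
  fun α hα => h α (D.compact_subset hα)

/-- **Non-degenerate limits are nonzero.** [folklore] -/
theorem IsNondegenerateLimit.isNonzeroLimit (h : D.IsNondegenerateLimit) : D.IsNonzeroLimit :=
  fun α hα _ => h α hα

/-- Discrete series are nonzero. [folklore] -/
theorem IsDiscreteSeries.isNonzeroLimit (h : D.IsDiscreteSeries) : D.IsNonzeroLimit :=
  h.isNondegenerateLimit.isNonzeroLimit

/-- A simple root is positive. [folklore] -/
theorem IsSimpleRoot.mem {α : V} (h : D.IsSimpleRoot α) : α ∈ D.positiveRoots := h.1

section Decidable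

variable [DecidableEq V] [DecidableEq R]

/-- `IsSimpleRoot` is decidable. [folklore] -/
instance IsSimpleRoot.decidable (α : V) : Decidable (D.IsSimpleRoot α) := by
  unfold IsSimpleRoot; infer_instance

/-- `IsDiscreteSeries` is decidable. [folklore] -/
instance IsDiscreteSeries.decidable : Decidable D.IsDiscreteSeries := by
  unfold IsDiscreteSeries; infer_instance

/-- `IsNonzeroLimit` is decidable. [folklore] -/
instance IsNonzeroLimit.decidable : Decidable D.IsNonzeroLimit := by
  unfold IsNonzeroLimit; infer_instance

/-- `IsNondegenerateLimit` is decidable. [folklore] -/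
instance IsNondegenerateLimit.decidable : Decidable D.IsNondegenerateLimit := by
  unfold IsNondegenerateLimit; infer_instance

end Decidable

end LimitOfDiscreteSeriesData

/-! ### Worked lines: `so(2,5)` (type `B₃`) and `sp₄ ≅ so(2,3)` (type `C₂`)

Coordinates are INTEGER tuples and the parameters are doubled (`λ ↦ 2λ`), so that every line is
checked by `decide` in the kernel; `⟨·, ·⟩` is the standard dot product. -/

namespace KZExamples

open LimitOfDiscreteSeriesData

/-- Standard form on `ℤ³` (coordinates `(e₁; e₂, e₃)`). [folklore] -/
def dot3 (x y : ℤ × ℤ × ℤ) : ℤ := x.1 * y.1 + x.2.1 * y.2.1 + x.2.2 * y.2.2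

/-- Standard form on `ℤ²`. [folklore] -/
def dot2 (x y : ℤ × ℤ) : ℤ := x.1 * y.1 + x.2 * y.2

/-- The `18` roots `±e_i ± e_j` (`i < j`), `±e_i` of type `B₃ = so(7)_ℂ ⊇ so(2,5)`. [folklore] -/
def rootsB3 : Finset (ℤ × ℤ × ℤ) :=
  {(1, 1, 0), (1, -1, 0), (-1, 1, 0), (-1, -1, 0), (1, 0, 1), (1, 0, -1), (-1, 0, 1), (-1, 0, -1),
    (0, 1, 1), (0, 1, -1), (0, -1, 1), (0, -1, -1), (1, 0, 0), (-1, 0, 0), (0, 1, 0), (0, -1, 0),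
    (0, 0, 1), (0, 0, -1)}

/-- The compact roots of `so(2,5)`: those of `K`, `𝔨 = so(2) ⊕ so(5)`, i.e. the `8` roots of
`so(5) = B₂` in the coordinates `e₂, e₃`: `±e₂ ± e₃, ±e₂, ±e₃`. [folklore] -/
def compactRootsSO25 : Finset (ℤ × ℤ × ℤ) :=
  {(0, 1, 1), (0, 1, -1), (0, -1, 1), (0, -1, -1), (0, 1, 0), (0, -1, 0), (0, 0, 1), (0, 0, -1)}

/-- The positive system (chamber) `e₂ > e₁ > e₃ > 0` of `B₃`: simple roots `e₂ − e₁, e₁ − e₃, e₃`.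
[folklore] -/
def positiveRootsB3 : Finset (ℤ × ℤ × ℤ) :=
  {(-1, 1, 0), (1, 1, 0), (1, 0, -1), (1, 0, 1), (0, 1, -1), (0, 1, 1), (1, 0, 0), (0, 1, 0),
    (0, 0, 1)}

/-- **`so(2,5)`, Hodge type `(1,2,2,1)`**: `λ = (1/2, 3/2, 1/2)` (doubled: `(1, 3, 1)`), chamber
`e₂ > e₁ > e₃ > 0` (census C1 of the `cy3-h21-two-gspin-census` card). [folklore] -/
def so25Hodge1221 : LimitOfDiscreteSeriesData dot3 where
  roots := rootsB3
  compactRoots := compactRootsSO25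
  positiveRoots := positiveRootsB3
  param := (1, 3, 1)
  compact_subset := by decide
  neg_mem_compact := by decide
  positive_subset := by decide
  mem_or_neg_mem := by decide
  neg_notMem := by decide
  dominant := by decide

/-- `λ = (1/2, 3/2, 1/2)` is orthogonal exactly to the roots `±(e₁ − e₃)` (which are noncompact).
[folklore] -/
theorem so25Hodge1221_orthogonal_iff :
    ∀ α ∈ rootsB3, dot3 (1, 3, 1) α = 0 ↔ (α = (1, 0, -1) ∨ α = (-1, 0, 1)) := by decide

/-- … hence `(λ, Ψ)` is a **non-degenerate limit**, [folklore] -/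
theorem so25Hodge1221_isNondegenerateLimit : so25Hodge1221.IsNondegenerateLimit := by decide

/-- … nonzero, [folklore] -/
theorem so25Hodge1221_isNonzeroLimit : so25Hodge1221.IsNonzeroLimit :=
  so25Hodge1221_isNondegenerateLimit.isNonzeroLimit

/-- … and NOT a discrete series (`λ ⊥ e₁ − e₃`). [folklore] -/
theorem so25Hodge1221_not_isDiscreteSeries : ¬ so25Hodge1221.IsDiscreteSeries := by decide

/-- **`so(2,5)`, Hodge type `(3,3)` (abelian threefolds)**: `λ = (1/2, 1/2, 1/2)` (doubled:
`(1, 1, 1)`), chamber `e₂ > e₁ > e₃ > 0` (one of the chambers whose closure contains `λ`).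
[folklore] -/
def so25Hodge33 : LimitOfDiscreteSeriesData dot3 where
  roots := rootsB3
  compactRoots := compactRootsSO25
  positiveRoots := positiveRootsB3
  param := (1, 1, 1)
  compact_subset := by decide
  neg_mem_compact := by decide
  positive_subset := by decide
  mem_or_neg_mem := by decide
  neg_notMem := by decide
  dominant := by decide

/-- `λ = (1/2, 1/2, 1/2)` is orthogonal to the COMPACT root `e₂ − e₃`: the datum is **degenerate**.
[folklore] -/
theorem so25Hodge33_not_isNondegenerateLimit : ¬ so25Hodge33.IsNondegenerateLimit := by decide

/-- … it is nevertheless a NONZERO limit for this chamber (its compact simple root is `e₃`,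
`⟨λ, e₃⟩ ≠ 0`; `e₂ − e₃ = (e₂ − e₁) + (e₁ − e₃)` is not simple), [folklore] -/
theorem so25Hodge33_isNonzeroLimit : so25Hodge33.IsNonzeroLimit := by decide

/-- … and not a discrete series. [folklore] -/
theorem so25Hodge33_not_isDiscreteSeries : ¬ so25Hodge33.IsDiscreteSeries := by decide

/-- The `Ψ`-simple roots of the chamber `e₂ > e₁ > e₃ > 0` of `B₃` are `e₂ − e₁, e₁ − e₃, e₃`
(the only compact one is `e₃`). [folklore] -/
theorem simpleRoots_B3 :
    (positiveRootsB3.filter fun α => so25Hodge33.IsSimpleRoot α) =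
      {(-1, 1, 0), (1, 0, -1), (0, 0, 1)} := by decide

/-- The `8` roots `±e₁ ± e₂, ±2e₁, ±2e₂` of type `C₂ = sp₄`. [folklore] -/
def rootsC2 : Finset (ℤ × ℤ) :=
  {(1, -1), (-1, 1), (1, 1), (-1, -1), (2, 0), (-2, 0), (0, 2), (0, -2)}

/-- The compact roots of `Sp₄(ℝ)`: those of `K = U(2)`, `±(e₁ − e₂)`. [folklore] -/
def compactRootsU2 : Finset (ℤ × ℤ) :=
  {(1, -1), (-1, 1)}

/-- The positive system `e₁ > e₂ > 0` of `C₂`: `e₁ − e₂, e₁ + e₂, 2e₁, 2e₂`. [folklore] -/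
def positiveRootsC2 : Finset (ℤ × ℤ) :=
  {(1, -1), (1, 1), (2, 0), (0, 2)}

/-- **`sp₄ ≅ so(2,3)`, Siegel weight `(2,2)`**: Harish-Chandra parameter `λ = (1, 0)`
(weight `(k₁, k₂) ↦ λ = (k₁ − 1, k₂ − 2)`), chamber `e₁ > e₂ > 0`. [cite: BoxerEtAl2021, §1.4.1] -/
def sp4Siegel22 : LimitOfDiscreteSeriesData dot2 where
  roots := rootsC2
  compactRoots := compactRootsU2
  positiveRoots := positiveRootsC2
  param := (1, 0)
  compact_subset := by decide
  neg_mem_compact := by decide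
  positive_subset := by decide
  mem_or_neg_mem := by decide
  neg_notMem := by decide
  dominant := by decide

/-- The weight-`(2,2)` parameter is orthogonal only to the noncompact long roots `±2e₂`: a
**non-degenerate limit of discrete series** … [cite: BoxerEtAl2021, §1.4.1] -/
theorem sp4Siegel22_isNondegenerateLimit : sp4Siegel22.IsNondegenerateLimit := by decide

/-- … which is not a discrete series. [cite: BoxerEtAl2021, §1.4.1] -/
theorem sp4Siegel22_not_isDiscreteSeries : ¬ sp4Siegel22.IsDiscreteSeries := by decide

/-- The `Ψ`-simple roots of the chamber `e₁ > e₂ > 0` of `C₂` are `e₁ − e₂` (compact) and `2e₂`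
(noncompact). [folklore] -/
theorem simpleRoots_C2 :
    (positiveRootsC2.filter fun α => sp4Siegel22.IsSimpleRoot α) = {(1, -1), (0, 2)} := by decide

end KZExamples

end Literature.RepresentationTheory.Semisimple
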